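import Literature.AlgebraicGeometry.Morphisms.ContainmentChartFiniteFlat
import Literature.AlgebraicGeometry.Morphisms.IdealSheafLeKerLocal
import Literature.AlgebraicGeometry.Morphisms.ContainmentLocusClosed
import Literature.AlgebraicGeometry.Morphisms.CohOfVectorBundle
import Literature.AlgebraicGeometry.Modules.SheafHomFrames
import Literature.AlgebraicGeometry.Modules.DeterminantCocycle
import Mathlib.AlgebraicGeometry.Morphisms.FlatRank
import HarnessLib

/-!
# The containment locus for a finite locally free `X → S`: the sheaf socket `hrep` discharged, «`f = g`» closed

Topic `Literature/AlgebraicGeometry/Morphisms`; theorems only (no definition, no named fact, no instance, no `sorry`).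
Cell hodgecm-mathlib, F-DAG (h6), file 3 of 3 of the finite-flat road (file 1 ★ `Morphisms/IdealSheafLeKerLocal`,
file 2 ★ `Morphisms/ContainmentChartFiniteFlat`).  HC_CM is proved only modulo the 7 printed citations until rung 0
closes; nothing here is about HC.

★ `Morphisms/ContainmentLocusClosed` proves that for `p : X ⟶ S` and a closed subscheme `Z = V(𝓘) ⊆ X` the CONTAINMENT
subfunctor «`T ↦ [X_T ⊆ Z_T]`» (`𝓘 ≤ (X ×_S T ⟶ X).ker`) — and with it «`f = g`» for `S`-morphisms into a separated
`S`-scheme (★ `Morphisms/EqualizerLocusClosed`) — is represented by a CLOSED subscheme of `S` as soon as ONE sheaf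
socket is supplied:

  `hrep : ∀ ⦃T⦄ (b : T ⟶ S), 𝓘 ≤ (pullback.fst p b).ker ↔ (Scheme.Modules.pullback b).map u = 0`

for some `u : 𝓔 ⟶ 𝓥` into a vector bundle on `S`.  THIS FILE DISCHARGES `hrep` when `p` is FINITE LOCALLY FREE — affine
with `Γ(X, p⁻¹W)` finite projective over `Γ(S, W)` on an affine cover ([GortzWedhorn2020] Def. 12.18 / Prop. 12.19), in
particular `p` finite and flat over a locally noetherian `S` — with the witness

  `u := p_*(𝓘_Z ↪ 𝒪_X) : p_*𝓘_Z ⟶ p_*𝒪_X`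

(★ `Modules/IdealSheafOfClosedImmersion`, Mathlib `Scheme.Modules.pushforward`; `p_*𝒪_X` is a vector bundle by ★
`Modules/PushforwardFiniteLocallyFree` / file 2).  Proof: both sides of `hrep` are local on `T` and can be tested on affine
charts (file 1: `le_ker_iff_of_affine_charts`, Mathlib `Scheme.Pullback.openCoverOfRight`); on a chart where `p_*𝒪_X` is
free they agree by the elementary algebra of file 2 (`x ⊗ 1 = 0` in `A' ⊗_A B` iff every coordinate of `x` dies in `A'`);
and «`V(u) ≤ b.ker` ⟺ `b^*u = 0`» is ★ `Modules/VanishingLocusOfHom.vanishingIdeal_le_ker_iff`.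

CONSEQUENCES (§4): for `X → S` finite locally free, «`X_T ⊆ Z_T`» is a CLOSED condition on `S` (represented by
`V(u) ⊆ S`), and for two `S`-morphisms `f g : X ⟶ Y` into a separated `S`-scheme — e.g. two homomorphisms out of a finite
flat group scheme (`A[N]`, `K(L)`, the kernel of an isogeny) — «`f = g`» is a CLOSED condition on `S`
(consumers in the F-DAG: (h5-C) `K(L)`/«`K ⊆ ker φ`» inside `A[m]`, F-10 level descent, (h9) `K_m(λ) ⊆ A[m]`).

* §1 `isAffineLocalizing_pushforward_idealSheafOf` (side socket `hE`; `hV` is ★ `coh_of_isVectorBundle` of the dual bundle, =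
  ★ `HodgeTheory/ZeroSchemeRegularImmersion.isAffineLocalizing_dual_of_isFiniteLocallyFree`, inlined to keep imports light);
* §2 `le_ker_fst_iff_vanishingIdeal_le_ker`, **`le_ker_fst_iff_pullback_map_eq_zero`** (= `hrep`);
* §3 `le_ker_fst_iff_pullback_map_eq_zero_of_finite_projective_app`, `finite_projective_app_of_isFinite_of_flat`,
  `le_ker_fst_iff_pullback_map_eq_zero_of_isFinite_of_flat`;
* §4 `exists_comp_subschemeι_eq_iff_le_ker_fst_of_finite_projective_app`,
  `exists_idealSheafData_le_ker_iff_le_ker_fst_of_finite_projective_app`,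
  `exists_idealSheafData_le_ker_iff_pullback_map_eq_of_finite_projective_app`,
  `exists_idealSheafData_le_ker_iff_pullback_map_eq_of_isFinite_of_flat`;
* §5 `finite_projective_app_id`, **`le_ker_iff_pullback_map_idealSheafOfι_eq_zero`** — the case `p = 𝟙 X`:
  `𝓘 ≤ g.ker ↔ g^*(𝓘_Z ↪ 𝒪_X) = 0` for ANY `g : T ⟶ X` («GAP 0» of the projective-flat (h6-d) chain: the ideal-sheaf
  condition as the vanishing of the pulled-back inclusion of the ideal module; Mathlib `pushforwardId`, `Hom.ker_comp_of_isIso`).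

## References
* [GortzWedhorn2020] U. Görtz, T. Wedhorn, *Algebraic Geometry I: Schemes*, 2nd ed. (2020): Definition 12.18 and
  Proposition 12.19 (pp. 331–332) (finite locally free morphisms), Prop. 12.13 (p. 330), Definition/Proposition 9.7 (ii)
  (`Eq(f,g) ⊆ X` closed for `Y/S` separated).
* [MumfordFogartyKirwan1994] D. Mumford, J. Fogarty, F. Kirwan, *Geometric Invariant Theory*, 3rd ed. (1994), Ch. 6 §3
  Prop. 6.16 (p. 126) (closed conditions on the base via a map into a locally free sheaf).
-/

noncomputable section

-- `TopCat.Presheaf`/`Scheme.Modules` are not reducible (as in Mathlib's `AlgebraicGeometry/Modules`).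
set_option backward.isDefEq.respectTransparency false

open CategoryTheory CategoryTheory.Limits AlgebraicGeometry TopologicalSpace Opposite TensorProduct

universe u

namespace Literature.AlgebraicGeometry.Morphisms

open Literature.AlgebraicGeometry.Modules Literature.AlgebraicGeometry.Motives

variable {X S : Scheme.{u}} (p : X ⟶ S) (I : X.IdealSheafData)

/-! ## §1 The side socket `hE` for `u = p_*(𝓘_Z ↪ 𝒪_X)` -/

/-- `p_*𝓘_Z` is affine-localizing (quasi-coherent) for `p` affine (★ `isAffineLocalizing_pushforward_of_isAffineHom`,
★ `isAffineLocalizing_idealSheafOf`). [cite: GortzWedhorn2020, Definition 12.18 and Proposition 12.19 (pp. 331–332)] -/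
theorem isAffineLocalizing_pushforward_idealSheafOf [IsAffineHom p] :
    IsAffineLocalizing ((Scheme.Modules.pushforward p).obj (idealSheafOf I.subschemeι)) :=
  isAffineLocalizing_pushforward_of_isAffineHom p (isAffineLocalizing_idealSheafOf _)

/-! ## §2 Assembly: `𝓘 ≤ pr.ker ↔ V(u) ≤ b.ker ↔ b^*u = 0` -/

/-- **Containment `X_T ⊆ Z_T` ⟺ `T → S` lands in `V(u)`, ideal form**: for `p : X ⟶ S` affine with affine frame charts
of `p_*𝒪_X` (finite locally free), `𝓘` an ideal sheaf on `X` and `u := p_*(𝓘_Z ↪ 𝒪_X)`: for every `b : T ⟶ S`,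
`𝓘 ≤ (X ×_S T ⟶ X).ker ↔ V(u) ≤ b.ker` (both sides are local on `T` and testable on affine charts — ★
`IdealSheafLeKerLocal.le_ker_iff_of_affine_charts` — where they agree by ★
`appLE_fst_eq_zero_iff_appLE_vanishingIdeal_eq_zero`). [cite: MumfordFogartyKirwan1994, Ch. 6 §3 Prop. 6.16 (p. 126)]
[cite: GortzWedhorn2020, Definition 12.18 and Proposition 12.19 (pp. 331–332)] -/
theorem le_ker_fst_iff_vanishingIdeal_le_ker [IsAffineHom p]
    (hfr : ∀ s : S, ∃ W : S.Opens, s ∈ W ∧ IsAffineOpen W ∧ ∃ (ι : Type u) (_ : Finite ι),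
      Nonempty (SheafOfModules.free ι ≅ ((Scheme.Modules.pushforward p).obj (unitModule X)).over W))
    (hE : IsAffineLocalizing ((Scheme.Modules.pushforward p).obj (idealSheafOf I.subschemeι)))
    (hV : IsAffineLocalizing (dual ((Scheme.Modules.pushforward p).obj (unitModule X))))
    {T : Scheme.{u}} (b : T ⟶ S) :
    I ≤ (pullback.fst p b).ker ↔
      vanishingIdeal ((Scheme.Modules.pushforward p).map (idealSheafOfι I.subschemeι)) ≤ b.ker := by
  classical
  choose Wc hsW hWaff ιc hιc ec using hfr
  -- the affine frame charts cover `S`, their preimages cover `X`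
  have hU : ⨆ s, (⟨Wc s, hWaff s⟩ : S.affineOpens).1 = ⊤ :=
    top_le_iff.mp fun s _ => Opens.mem_iSup.mpr ⟨s, hsW s⟩
  have hU' : ⨆ s, (⟨p ⁻¹ᵁ Wc s, (hWaff s).preimage p⟩ : X.affineOpens).1 = ⊤ :=
    top_le_iff.mp fun x _ => Opens.mem_iSup.mpr ⟨p x, hsW (p x)⟩
  -- `T`-charts: affine opens `V' ⊆ b⁻¹W_s`; `X ×_S T`-charts: `pr⁻¹(p⁻¹W_s) ∩ p_T⁻¹(V')`
  have hR := le_ker_iff_of_affine_charts b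
    (vanishingIdeal ((Scheme.Modules.pushforward p).map (idealSheafOfι I.subschemeι)))
    (fun s => ⟨Wc s, hWaff s⟩) hU
    (κ := fun s => {V' : T.affineOpens // (V' : T.Opens) ≤ b ⁻¹ᵁ Wc s})
    (fun s V' => (V'.1 : T.Opens)) (fun s V' => V'.2) (fun s => by
      intro t ht
      obtain ⟨_, ⟨V', hV', rfl⟩, htV', hV'le⟩ :=
        T.isBasis_affineOpens.exists_subset_of_mem_open ht (b ⁻¹ᵁ Wc s).isOpen
      exact Opens.mem_iSup.mpr ⟨⟨⟨V', hV'⟩, hV'le⟩, htV'⟩)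
  have hL := le_ker_iff_of_affine_charts (pullback.fst p b) I
    (fun s => ⟨p ⁻¹ᵁ Wc s, (hWaff s).preimage p⟩) hU'
    (κ := fun s => {V' : T.affineOpens // (V' : T.Opens) ≤ b ⁻¹ᵁ Wc s})
    (fun s V' => pullback.fst p b ⁻¹ᵁ (p ⁻¹ᵁ Wc s) ⊓ pullback.snd p b ⁻¹ᵁ (V'.1 : T.Opens))
    (fun s V' => inf_le_left) (fun s => by
      intro z hz
      have hz' : pullback.snd p b z ∈ b ⁻¹ᵁ Wc s := by
        change (pullback.snd p b ≫ b) z ∈ Wc s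
        rw [← pullback.condition]
        exact hz
      obtain ⟨_, ⟨V', hV', rfl⟩, hzV', hV'le⟩ :=
        T.isBasis_affineOpens.exists_subset_of_mem_open hz' (b ⁻¹ᵁ Wc s).isOpen
      exact Opens.mem_iSup.mpr ⟨⟨⟨V', hV'⟩, hV'le⟩, hz, hzV'⟩)
  rw [hL, hR]
  refine forall_congr' fun s => forall_congr' fun V' => ?_
  obtain ⟨e⟩ := ec s
  haveI := hιc s
  exact appLE_fst_eq_zero_iff_appLE_vanishingIdeal_eq_zero p I b (hWaff s) V'.1.2 V'.2 e hE hV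

/-- **THE FINITE-FLAT DISCHARGE OF THE SHEAF SOCKET `hrep`** of ★ `Morphisms/ContainmentLocusClosed`: for `p : X ⟶ S`
affine with affine frame charts of `p_*𝒪_X`, and `u := p_*(𝓘_Z ↪ 𝒪_X)` (a morphism from a quasi-coherent module to a
vector bundle on `S`): `𝓘 ≤ (X ×_S T ⟶ X).ker ↔ b^*u = 0` for every `b : T ⟶ S` (★ `vanishingIdeal_le_ker_iff`).
[cite: MumfordFogartyKirwan1994, Ch. 6 §3 Prop. 6.16 (p. 126)]
[cite: GortzWedhorn2020, Definition 12.18 and Proposition 12.19 (pp. 331–332)] -/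
theorem le_ker_fst_iff_pullback_map_eq_zero [IsAffineHom p]
    (hfr : ∀ s : S, ∃ W : S.Opens, s ∈ W ∧ IsAffineOpen W ∧ ∃ (ι : Type u) (_ : Finite ι),
      Nonempty (SheafOfModules.free ι ≅ ((Scheme.Modules.pushforward p).obj (unitModule X)).over W))
    ⦃T : Scheme.{u}⦄ (b : T ⟶ S) :
    I ≤ (pullback.fst p b).ker ↔
      (Scheme.Modules.pullback b).map ((Scheme.Modules.pushforward p).map (idealSheafOfι I.subschemeι)) = 0 := by
  have hflf : IsFiniteLocallyFree ((Scheme.Modules.pushforward p).obj (unitModule X)) := fun s => by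
    obtain ⟨W, hsW, -, ι, hι, e⟩ := hfr s
    exact ⟨W, hsW, ι, hι, e⟩
  have hE := isAffineLocalizing_pushforward_idealSheafOf p I
  have hV := (coh_of_isVectorBundle (isFiniteLocallyFree_dual hflf).isVectorBundle).loc
  exact (le_ker_fst_iff_vanishingIdeal_le_ker p I hfr hE hV b).trans
    (vanishingIdeal_le_ker_iff _ b (frameSystemOfIsFiniteLocallyFree hflf) hE hV)

/-! ## §3 User-facing forms: finite projective charts (GW I Def. 12.18) / finite flat over a locally noetherian base -/

/-- `hrep` for `p` affine with `Γ(X, p⁻¹W)` finite projective over `Γ(S, W)` on an affine cover (Görtz–Wedhorn I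
Def. 12.18: `p` finite locally free). [cite: GortzWedhorn2020, Definition 12.18 and Proposition 12.19 (pp. 331–332)]
[cite: MumfordFogartyKirwan1994, Ch. 6 §3 Prop. 6.16 (p. 126)] -/
theorem le_ker_fst_iff_pullback_map_eq_zero_of_finite_projective_app [IsAffineHom p]
    (hp : ∀ s : S, ∃ W : S.Opens, s ∈ W ∧ IsAffineOpen W ∧
      letI := (p.app W).hom.toAlgebra
      Module.Finite Γ(S, W) Γ(X, p ⁻¹ᵁ W) ∧ Module.Projective Γ(S, W) Γ(X, p ⁻¹ᵁ W))
    ⦃T : Scheme.{u}⦄ (b : T ⟶ S) :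
    I ≤ (pullback.fst p b).ker ↔
      (Scheme.Modules.pullback b).map ((Scheme.Modules.pushforward p).map (idealSheafOfι I.subschemeι)) = 0 :=
  le_ker_fst_iff_pullback_map_eq_zero p I (exists_affine_frame_of_finite_projective_app p hp) b

/-- A finite flat morphism onto a locally noetherian scheme has finite projective affine charts (finite and flat over
a noetherian ring ⇒ finitely presented and flat ⇒ projective; Mathlib `Module.Flat.projective_of_finitePresentation`).
[cite: GortzWedhorn2020, Definition 12.18 and Proposition 12.19 (pp. 331–332)] -/
theorem finite_projective_app_of_isFinite_of_flat [IsFinite p] [Flat p] [IsLocallyNoetherian S] (s : S) :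
    ∃ W : S.Opens, s ∈ W ∧ IsAffineOpen W ∧
      letI := (p.app W).hom.toAlgebra
      Module.Finite Γ(S, W) Γ(X, p ⁻¹ᵁ W) ∧ Module.Projective Γ(S, W) Γ(X, p ⁻¹ᵁ W) := by
  obtain ⟨_, ⟨W, hW, rfl⟩, hsW, -⟩ :=
    S.isBasis_affineOpens.exists_subset_of_mem_open (Set.mem_univ s) isOpen_univ
  letI : Algebra Γ(S, W) Γ(X, p ⁻¹ᵁ W) := (p.app W).hom.toAlgebra
  haveI : IsNoetherianRing Γ(S, W) := IsLocallyNoetherian.component_noetherian ⟨W, hW⟩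
  have hfin : Module.Finite Γ(S, W) Γ(X, p ⁻¹ᵁ W) := p.finite_app W hW
  have hflat : Module.Flat Γ(S, W) Γ(X, p ⁻¹ᵁ W) := by
    have h := p.flat_appLE hW (hW.preimage p) le_rfl
    rw [← Scheme.Hom.app_eq_appLE] at h
    exact h
  haveI : Module.FinitePresentation Γ(S, W) Γ(X, p ⁻¹ᵁ W) :=
    Module.finitePresentation_of_finite Γ(S, W) Γ(X, p ⁻¹ᵁ W)
  exact ⟨W, hsW, hW, hfin, Module.Flat.projective_of_finitePresentation⟩

/-- **`hrep` for `p` finite and flat over a locally noetherian base.**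
[cite: GortzWedhorn2020, Definition 12.18 and Proposition 12.19 (pp. 331–332)] [cite: MumfordFogartyKirwan1994, Ch. 6 §3 Prop. 6.16 (p. 126)] -/
theorem le_ker_fst_iff_pullback_map_eq_zero_of_isFinite_of_flat [IsFinite p] [Flat p] [IsLocallyNoetherian S]
    ⦃T : Scheme.{u}⦄ (b : T ⟶ S) :
    I ≤ (pullback.fst p b).ker ↔
      (Scheme.Modules.pullback b).map ((Scheme.Modules.pushforward p).map (idealSheafOfι I.subschemeι)) = 0 :=
  le_ker_fst_iff_pullback_map_eq_zero_of_finite_projective_app p I (finite_projective_app_of_isFinite_of_flat p) b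

/-! ## §4 Consequences: containment and «`f = g`» are CLOSED conditions for a finite locally free source -/

/-- **«`X_T ⊆ Z_T`» is a closed condition on `S` for `X → S` finite locally free**: the closed subscheme `V(u) ⊆ S`
represents containment — `b : T ⟶ S` factors through `V(u)` iff `X_T ⊆ Z_T` (★ `ContainmentLocusClosed` heads with
`hrep` discharged). [cite: MumfordFogartyKirwan1994, Ch. 6 §3 Prop. 6.16 (p. 126)]
[cite: GortzWedhorn2020, Definition 12.18 and Proposition 12.19 (pp. 331–332)] -/
theorem exists_comp_subschemeι_eq_iff_le_ker_fst_of_finite_projective_app [IsAffineHom p]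
    (hp : ∀ s : S, ∃ W : S.Opens, s ∈ W ∧ IsAffineOpen W ∧
      letI := (p.app W).hom.toAlgebra
      Module.Finite Γ(S, W) Γ(X, p ⁻¹ᵁ W) ∧ Module.Projective Γ(S, W) Γ(X, p ⁻¹ᵁ W))
    {T : Scheme.{u}} (b : T ⟶ S) :
    (∃ b' : T ⟶ (vanishingIdeal ((Scheme.Modules.pushforward p).map (idealSheafOfι I.subschemeι))).subscheme,
        b' ≫ (vanishingIdeal ((Scheme.Modules.pushforward p).map (idealSheafOfι I.subschemeι))).subschemeι = b) ↔
      I ≤ (pullback.fst p b).ker :=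
  have hflf := isFiniteLocallyFree_pushforward_unit_of_finite_projective_app p hp
  exists_comp_subschemeι_eq_iff_containment p I _ (frameSystemOfIsFiniteLocallyFree hflf)
    (isAffineLocalizing_pushforward_idealSheafOf p I) ((coh_of_isVectorBundle (isFiniteLocallyFree_dual hflf).isVectorBundle).loc)
    (le_ker_fst_iff_pullback_map_eq_zero_of_finite_projective_app p I hp) b

/-- **The containment subfunctor is represented by a closed subscheme of `S`** (existence form, for `X → S` affine with
finite projective affine charts). [cite: MumfordFogartyKirwan1994, Ch. 6 §3 Prop. 6.16 (p. 126)]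
[cite: GortzWedhorn2020, Definition 12.18 and Proposition 12.19 (pp. 331–332)] -/
theorem exists_idealSheafData_le_ker_iff_le_ker_fst_of_finite_projective_app [IsAffineHom p]
    (hp : ∀ s : S, ∃ W : S.Opens, s ∈ W ∧ IsAffineOpen W ∧
      letI := (p.app W).hom.toAlgebra
      Module.Finite Γ(S, W) Γ(X, p ⁻¹ᵁ W) ∧ Module.Projective Γ(S, W) Γ(X, p ⁻¹ᵁ W)) :
    ∃ J : S.IdealSheafData, ∀ ⦃T : Scheme.{u}⦄ (b : T ⟶ S), J ≤ b.ker ↔ I ≤ (pullback.fst p b).ker :=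
  have hflf := isFiniteLocallyFree_pushforward_unit_of_finite_projective_app p hp
  ⟨vanishingIdeal ((Scheme.Modules.pushforward p).map (idealSheafOfι I.subschemeι)), fun _ b =>
    (le_ker_fst_iff_vanishingIdeal_le_ker p I (exists_affine_frame_of_finite_projective_app p hp)
      (isAffineLocalizing_pushforward_idealSheafOf p I) ((coh_of_isVectorBundle (isFiniteLocallyFree_dual hflf).isVectorBundle).loc) b).symm⟩

/-- **«`f = g`» is a closed condition on `S` for two `S`-morphisms out of a FINITE LOCALLY FREE `S`-scheme into a
separated `S`-scheme** (e.g. two homomorphisms from a finite flat group scheme such as `A[N]`, `K(L)` or an isogeny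
kernel): there is an ideal sheaf `J` on `S` with `J ≤ b.ker ↔ f_T = g_T` for every `b : T ⟶ S` (★ `EqualizerLocusClosed`
at the containment locus of `Eq(f,g)`). [cite: GortzWedhorn2020, Definition/Proposition 9.7 (ii)]
[cite: MumfordFogartyKirwan1994, Ch. 6 §3 Prop. 6.16 (p. 126)] -/
theorem exists_idealSheafData_le_ker_iff_pullback_map_eq_of_finite_projective_app {S : Scheme.{u}} {X Y : Over S}
    [IsAffineHom X.hom]
    (hp : ∀ s : S, ∃ W : S.Opens, s ∈ W ∧ IsAffineOpen W ∧
      letI := (X.hom.app W).hom.toAlgebra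
      Module.Finite Γ(S, W) Γ(X.left, X.hom ⁻¹ᵁ W) ∧ Module.Projective Γ(S, W) Γ(X.left, X.hom ⁻¹ᵁ W))
    (f g : X ⟶ Y) [IsSeparated Y.hom] :
    ∃ J : S.IdealSheafData, ∀ ⦃T : Scheme.{u}⦄ (b : T ⟶ S),
      J ≤ b.ker ↔ (Over.pullback b).map f = (Over.pullback b).map g := by
  obtain ⟨J, hJ⟩ := exists_idealSheafData_le_ker_iff_le_ker_fst_of_finite_projective_app X.hom
    (equalizer.ι f g).left.ker hp
  exact ⟨J, le_ker_iff_pullback_map_eq_of_containment f g J hJ⟩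

/-- The same for `X → S` finite and flat over a locally noetherian `S`. [cite: GortzWedhorn2020, Definition/Proposition 9.7 (ii)]
[cite: MumfordFogartyKirwan1994, Ch. 6 §3 Prop. 6.16 (p. 126)] -/
theorem exists_idealSheafData_le_ker_iff_pullback_map_eq_of_isFinite_of_flat {S : Scheme.{u}} {X Y : Over S}
    [IsFinite X.hom] [Flat X.hom] [IsLocallyNoetherian S] (f g : X ⟶ Y) [IsSeparated Y.hom] :
    ∃ J : S.IdealSheafData, ∀ ⦃T : Scheme.{u}⦄ (b : T ⟶ S),
      J ≤ b.ker ↔ (Over.pullback b).map f = (Over.pullback b).map g :=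
  exists_idealSheafData_le_ker_iff_pullback_map_eq_of_finite_projective_app
    (finite_projective_app_of_isFinite_of_flat X.hom) f g

/-! ## §5 The case `p = 𝟙`: `𝓘 ≤ g.ker ↔ g^*(𝓘_Z ↪ 𝒪_X) = 0` («GAP 0» of the (h6-d) chain) -/

/-- The identity morphism has finite projective affine charts (every affine `W`: `Γ(X, W)` over itself through
`(𝟙 X)^♯_W = 𝟙`). [cite: GortzWedhorn2020, Definition 12.18 and Proposition 12.19 (pp. 331–332)] -/
theorem finite_projective_app_id {X : Scheme.{u}} (x : X) :
    ∃ W : X.Opens, x ∈ W ∧ IsAffineOpen W ∧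
      letI := ((𝟙 X : X ⟶ X).app W).hom.toAlgebra
      Module.Finite Γ(X, W) Γ(X, (𝟙 X : X ⟶ X) ⁻¹ᵁ W) ∧ Module.Projective Γ(X, W) Γ(X, (𝟙 X : X ⟶ X) ⁻¹ᵁ W) := by
  obtain ⟨_, ⟨W, hW, rfl⟩, hxW, -⟩ :=
    X.isBasis_affineOpens.exists_subset_of_mem_open (Set.mem_univ x) isOpen_univ
  letI : Algebra Γ(X, W) Γ(X, (𝟙 X : X ⟶ X) ⁻¹ᵁ W) := ((𝟙 X : X ⟶ X).app W).hom.toAlgebra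
  have hfin : Module.Finite Γ(X, W) Γ(X, (𝟙 X : X ⟶ X) ⁻¹ᵁ W) := Module.Finite.self Γ(X, W)
  have hproj : Module.Projective Γ(X, W) Γ(X, (𝟙 X : X ⟶ X) ⁻¹ᵁ W) :=
    (inferInstance : Module.Projective Γ(X, W) Γ(X, W))
  exact ⟨W, hxW, hW, hfin, hproj⟩

/-- **`g : T ⟶ X` factors through the closed subscheme `V(𝓘)` iff `g^*(𝓘_Z ↪ 𝒪_X) = 0`** («GAP 0» of the (h6-d) chain:
the ideal-sheaf condition `𝓘 ≤ g.ker` as the vanishing of the pulled-back inclusion of the ideal MODULE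
`𝓘_Z = idealSheafOf` of ★ `Modules/IdealSheafOfClosedImmersion`) — the case `p := 𝟙 X` of ★
`le_ker_fst_iff_pullback_map_eq_zero_of_finite_projective_app` (Mathlib `pushforwardId`, `Hom.ker_comp_of_isIso`).
[cite: MumfordFogartyKirwan1994, Ch. 6 §3 Prop. 6.16 (p. 126)] [cite: GortzWedhorn2020, Section (4.11)] -/
theorem le_ker_iff_pullback_map_idealSheafOfι_eq_zero {X T : Scheme.{u}} (I : X.IdealSheafData) (g : T ⟶ X) :
    I ≤ g.ker ↔ (Scheme.Modules.pullback g).map (idealSheafOfι I.subschemeι) = 0 := by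
  have h := le_ker_fst_iff_pullback_map_eq_zero_of_finite_projective_app (𝟙 X) I finite_projective_app_id g
  -- `pullback.fst (𝟙 X) g = pullback.snd ≫ g`, an isomorphism followed by `g`
  have hfst : pullback.fst (𝟙 X) g = pullback.snd (𝟙 X) g ≫ g := by
    rw [← pullback.condition, Category.comp_id]
  rw [hfst, Scheme.Hom.ker_comp_of_isIso] at h
  rw [h]
  -- `(𝟙 X)_* ι ≅ ι`
  have hn := (Scheme.Modules.pushforwardId X).hom.naturality (idealSheafOfι I.subschemeι)
  simp only [Functor.id_map] at hn
  have hnat : (Scheme.Modules.pushforward (𝟙 X)).map (idealSheafOfι I.subschemeι) =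
      ((Scheme.Modules.pushforwardId X).hom.app (idealSheafOf I.subschemeι)) ≫ idealSheafOfι I.subschemeι ≫
        ((Scheme.Modules.pushforwardId X).inv.app (unitModule X)) := by
    rw [← Category.assoc, ← hn, Category.assoc, Iso.hom_inv_id_app, Category.comp_id]
  rw [hnat, Functor.map_comp, Functor.map_comp]
  constructor
  · intro h0
    have := h0
    rw [← Category.assoc] at this
    have h1 := (cancel_mono ((Scheme.Modules.pullback g).map
      ((Scheme.Modules.pushforwardId X).inv.app (unitModule X)))).mp (this.trans (zero_comp).symm)
    exact (cancel_epi ((Scheme.Modules.pullback g).map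
      ((Scheme.Modules.pushforwardId X).hom.app (idealSheafOf I.subschemeι)))).mp (h1.trans comp_zero.symm)
  · intro h0
    rw [h0, zero_comp, comp_zero]

end Literature.AlgebraicGeometry.Morphisms

end
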